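import Summits.KontsevichZagierPeriods.KontsevichZagierPeriods.Theorems.RootDecompRationalCubeDichotomyNashMultiGenP03

/-! # `RootDecompRationalCubeDichotomyNashMultiGenP04` — part 4/16 of the mechanical ≤385-line split of `NashEtaleMultiGen.lean`
(split by the decomp-kz census seat for landing; mathematics unchanged; part 4 continues part 3). -/

open Set MvPolynomial Filter Topology
open Literature.NumberTheory.Transcendental (IsSemialgebraicFunOn)
open Literature.ModelTheory.ExponentialFields (IsSemialgebraic isSemialgebraic_setOf_eval_pos
  isSemialgebraic_setOf_eval_ne_zero)

namespace Summit.KontsevichZagierPeriods.RootDecompRationalCubeDichotomy.Rung29430.MultiGen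
open Summit.KontsevichZagierPeriods.KontsevichZagierPeriods.Theses.RootDecompRationalCubeDichotomy
  (NashEtaleCover NashEtaleLocal PiRationalisation)
open Summit.KontsevichZagierPeriods.RootDecompRationalCubeDichotomy.Rung29430.NashEtaleLocalGlue
  (local_of_simple nashEtaleCover_of_nashEtaleLocal nashEtaleLocal_zero)
open Summit.KontsevichZagierPeriods.RootDecompRationalCubeDichotomy.Rung29430.NashEtaleLocalOne
  (analyticOnNhd_aeval_snoc)
open Summit.KontsevichZagierPeriods.RootDecompRationalCubeDichotomy.RungEtale.Etale
  (piRationalisation_of_nashEtaleCover)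

noncomputable section

/-! ## §4e  The `ℚ`-Nash implicit function theorem for polynomial étale systems — PROVED

INSTRUMENT for the special strata (the analytic half of the glue `SpecialStrataViaPowerSeries`):
`NashImplicit.exists_nash_implicit` — if `F₁..F_k ∈ ℚ[x, y]` vanish at `(x₀, y₀)` with
`det (∂Fᵢ/∂yⱼ)(x₀, y₀) ≠ 0`, then on an open rational box `V ∋ x₀` there are `u₁..u_k`, each
`ℚ`-SEMIALGEBRAIC and real-ANALYTIC on `V`, with `u(x₀) = y₀` and `F(x, u(x)) = 0` — exactly the
generator data of `MultiGenData`.  Ingredients (all Mathlib): the strict derivative of polynomial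
maps from `pderiv`; the inverse function theorem `HasStrictFDerivAt.toOpenPartialHomeomorph` for
`Ψ(x, y) = (x, F(x, y))` (block-triangular Jacobian, determinant `det ∂F/∂y`); analyticity of the
local inverse `OpenPartialHomeomorph.hasFPowerSeriesAt_symm`; `ℚ`-semialgebraicity of the graph
of `u` on a rational box by uniqueness of solutions inside a rational box in the source. -/

namespace NashImplicit

open Literature.NumberTheory.Transcendental Literature.ModelTheory.ExponentialFields

/-! ### §4e.1  Strict derivative of a polynomial map -/

/-- The derivative of `z ↦ p(z)` at `z₀`, as the continuous linear form
`v ↦ ∑ⱼ ∂ⱼp(z₀) vⱼ`. -/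
def D {N : ℕ} (p : MvPolynomial (Fin N) ℚ) (z₀ : Fin N → ℝ) : (Fin N → ℝ) →L[ℝ] ℝ :=
  ∑ j : Fin N, (MvPolynomial.aeval z₀ (pderiv j p)) • ContinuousLinearMap.proj j

/-- Auxiliary step `D_apply`. [bookkeeping] -/
theorem D_apply {N : ℕ} (p : MvPolynomial (Fin N) ℚ) (z₀ v : Fin N → ℝ) :
    D p z₀ v = ∑ j : Fin N, MvPolynomial.aeval z₀ (pderiv j p) * v j := by
  simp [D]

/-- Auxiliary step `hasStrictFDerivAt_aeval`. [bookkeeping] -/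
theorem hasStrictFDerivAt_aeval {N : ℕ} (p : MvPolynomial (Fin N) ℚ) (z₀ : Fin N → ℝ) :
    HasStrictFDerivAt (fun z : Fin N → ℝ => MvPolynomial.aeval z p) (D p z₀) z₀ := by
  classical
  induction p using MvPolynomial.induction_on with
  | C a =>
    have h1 : (fun z : Fin N → ℝ => MvPolynomial.aeval z (C a : MvPolynomial (Fin N) ℚ)) =
        fun _ => algebraMap ℚ ℝ a := by
      funext z
      simp
    have hD : D (C a : MvPolynomial (Fin N) ℚ) z₀ = 0 := by
      apply ContinuousLinearMap.ext
      intro v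
      simp [D_apply]
    rw [h1, hD]
    exact hasStrictFDerivAt_const _ _
  | add p q hp hq =>
    have h1 : (fun z : Fin N → ℝ => MvPolynomial.aeval z (p + q)) =
        fun z => MvPolynomial.aeval z p + MvPolynomial.aeval z q := by
      funext z
      simp
    have hD : D (p + q) z₀ = D p z₀ + D q z₀ := by
      apply ContinuousLinearMap.ext
      intro v
      simp [D_apply, Finset.sum_add_distrib, add_mul]
    rw [h1, hD]
    exact hp.add hq
  | mul_X p i hp =>
    have h1 : (fun z : Fin N → ℝ => MvPolynomial.aeval z (p * X i)) =
        fun z => MvPolynomial.aeval z p * z i := by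
      funext z
      simp
    rw [h1]
    have h := hp.mul (hasStrictFDerivAt_apply (𝕜 := ℝ) i z₀)
    refine h.congr_fderiv ?_
    apply ContinuousLinearMap.ext
    intro v
    simp only [add_apply, FunLike.coe_smul, Pi.smul_apply,
      ContinuousLinearMap.proj_apply, smul_eq_mul, D_apply, Derivation.leibniz, pderiv_X,
      smul_eq_mul, map_add, map_mul, MvPolynomial.aeval_X, add_mul, Finset.sum_add_distrib]
    have h2 : ∑ j : Fin N, MvPolynomial.aeval z₀ p *
        (algebraMap ℚ ℝ) ((Pi.single (M := fun _ => ℚ) j (1 : ℚ) : Fin N → ℚ) i) * v j =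
        MvPolynomial.aeval z₀ p * v i := by
      rw [Finset.sum_eq_single i]
      · simp
      · intro j _ hj
        simp [Ne.symm hj]
      · simp
    rw [Finset.mul_sum]
    have h3 : ∀ j : Fin N, MvPolynomial.aeval z₀ (Pi.single (M := fun _ => MvPolynomial (Fin N) ℚ)
        j (1 : MvPolynomial (Fin N) ℚ) i) = (algebraMap ℚ ℝ) ((Pi.single (M := fun _ => ℚ) j
        (1 : ℚ) : Fin N → ℚ) i) := by
      intro j
      by_cases hji : j = i
      · subst hji
        simp
      · simp [Ne.symm hji]
    simp only [h3]
    rw [h2]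
    congr 1
    refine Finset.sum_congr rfl fun j _ => ?_
    ring

/-! ### §4e.2  The map `Ψ(x, y) = (x, F(x, y))` and its Jacobian -/

variable {n k : ℕ}

/-- `Ψ_F (x, y) = (x, F(x, y))` on `ℝⁿ⁺ᵏ` (coordinates `Fin.castAdd` = `x`, `Fin.natAdd` = `y`). -/
def Psi (F : Fin k → MvPolynomial (Fin (n + k)) ℚ) (z : Fin (n + k) → ℝ) : Fin (n + k) → ℝ :=
  Fin.append (fun i : Fin n => z (Fin.castAdd k i)) (fun j : Fin k => MvPolynomial.aeval z (F j))

/-- The derivative of `Ψ_F` at `z₀`. -/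
def PsiDeriv (F : Fin k → MvPolynomial (Fin (n + k)) ℚ) (z₀ : Fin (n + k) → ℝ) :
    (Fin (n + k) → ℝ) →L[ℝ] (Fin (n + k) → ℝ) :=
  ContinuousLinearMap.pi fun r : Fin (n + k) =>
    Fin.addCases (motive := fun _ => (Fin (n + k) → ℝ) →L[ℝ] ℝ)
      (fun i => ContinuousLinearMap.proj (Fin.castAdd k i)) (fun j => D (F j) z₀) r

/-- Auxiliary step `Psi_apply_castAdd`. [bookkeeping] -/
theorem Psi_apply_castAdd (F : Fin k → MvPolynomial (Fin (n + k)) ℚ) (z : Fin (n + k) → ℝ)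
    (i : Fin n) : Psi F z (Fin.castAdd k i) = z (Fin.castAdd k i) := by
  simp [Psi]

/-- Auxiliary step `Psi_apply_natAdd`. [bookkeeping] -/
theorem Psi_apply_natAdd (F : Fin k → MvPolynomial (Fin (n + k)) ℚ) (z : Fin (n + k) → ℝ)
    (j : Fin k) : Psi F z (Fin.natAdd n j) = MvPolynomial.aeval z (F j) := by
  simp [Psi]

/-- Auxiliary step `hasStrictFDerivAt_Psi`. [bookkeeping] -/
theorem hasStrictFDerivAt_Psi (F : Fin k → MvPolynomial (Fin (n + k)) ℚ) (z₀ : Fin (n + k) → ℝ) :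
    HasStrictFDerivAt (Psi F) (PsiDeriv F z₀) z₀ := by
  rw [hasStrictFDerivAt_pi']
  intro r
  rw [PsiDeriv, ContinuousLinearMap.proj_pi]
  induction r using Fin.addCases with
  | left i =>
    simp only [Fin.addCases_left, Psi_apply_castAdd]
    exact hasStrictFDerivAt_apply (𝕜 := ℝ) _ z₀
  | right j =>
    simp only [Fin.addCases_right, Psi_apply_natAdd]
    exact hasStrictFDerivAt_aeval (F j) z₀

/-- Auxiliary step `analyticAt_Psi`. [bookkeeping] -/
theorem analyticAt_Psi (F : Fin k → MvPolynomial (Fin (n + k)) ℚ) (z₀ : Fin (n + k) → ℝ) :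
    AnalyticAt ℝ (Psi F) z₀ := by
  have : Psi F = fun z r => (fun r z => Psi F z r) r z := rfl
  rw [this]
  apply AnalyticAt.pi
  intro r
  induction r using Fin.addCases with
  | left i =>
    simp only [Psi_apply_castAdd]
    exact (ContinuousLinearMap.proj (R := ℝ) (φ := fun _ : Fin (n + k) => ℝ)
      (Fin.castAdd k i)).analyticAt z₀
  | right j =>
    simp only [Psi_apply_natAdd]
    exact AnalyticAt.aeval_mvPolynomial (fun i => (ContinuousLinearMap.proj (R := ℝ)
      (φ := fun _ : Fin (n + k) => ℝ) i).analyticAt z₀) (F j)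

/-- The `y`-Jacobian `(∂Fᵢ/∂yⱼ (z₀))ᵢⱼ`. -/
def Jy (F : Fin k → MvPolynomial (Fin (n + k)) ℚ) (z₀ : Fin (n + k) → ℝ) : Matrix (Fin k) (Fin k) ℝ :=
  Matrix.of fun i j : Fin k => MvPolynomial.aeval z₀ (pderiv (Fin.natAdd n j) (F i))

/-- The `x`-Jacobian `(∂Fᵢ/∂xⱼ (z₀))ᵢⱼ`. -/
def Jx (F : Fin k → MvPolynomial (Fin (n + k)) ℚ) (z₀ : Fin (n + k) → ℝ) : Matrix (Fin k) (Fin n) ℝ :=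
  Matrix.of fun i j => MvPolynomial.aeval z₀ (pderiv (Fin.castAdd k j) (F i))

/-- Auxiliary step `D_single`. [bookkeeping] -/
theorem D_single {N : ℕ} (p : MvPolynomial (Fin N) ℚ) (z₀ : Fin N → ℝ) (c : Fin N) :
    D p z₀ (Pi.single c 1) = MvPolynomial.aeval z₀ (pderiv c p) := by
  classical
  rw [D_apply, Finset.sum_eq_single c]
  · simp
  · intro j _ hj
    simp [hj]
  · simp

/-- Auxiliary step `toMatrix_PsiDeriv`. [bookkeeping] -/
theorem toMatrix_PsiDeriv (F : Fin k → MvPolynomial (Fin (n + k)) ℚ) (z₀ : Fin (n + k) → ℝ) :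
    LinearMap.toMatrix' (PsiDeriv F z₀ : (Fin (n + k) → ℝ) →ₗ[ℝ] (Fin (n + k) → ℝ)) =
      Matrix.reindex finSumFinEquiv finSumFinEquiv
        (Matrix.fromBlocks (1 : Matrix (Fin n) (Fin n) ℝ) 0 (Jx F z₀) (Jy F z₀)) := by
  classical
  refine Matrix.ext fun r c => ?_
  rw [LinearMap.toMatrix'_apply, Matrix.reindex_apply, Matrix.submatrix_apply]
  simp only [ContinuousLinearMap.coe_coe, PsiDeriv, ContinuousLinearMap.pi_apply]
  induction r using Fin.addCases with
  | left i =>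
    simp only [Fin.addCases_left, ContinuousLinearMap.proj_apply, finSumFinEquiv_symm_apply_castAdd]
    induction c using Fin.addCases with
    | left i' =>
      simp only [finSumFinEquiv_symm_apply_castAdd, Matrix.fromBlocks_apply₁₁, Pi.single_apply,
        Matrix.one_apply]
      simp [Fin.castAdd_inj]
    | right j' =>
      simp only [finSumFinEquiv_symm_apply_natAdd, Matrix.fromBlocks_apply₁₂, Pi.single_apply,
        Matrix.zero_apply]
      rw [if_neg]
      intro h
      have := congrArg Fin.val h
      simp at this
      omega
  | right j =>
    simp only [Fin.addCases_right, D_single, finSumFinEquiv_symm_apply_natAdd]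
    induction c using Fin.addCases with
    | left i' =>
      simp [finSumFinEquiv_symm_apply_castAdd, Matrix.fromBlocks_apply₂₁, Jx]
    | right j' =>
      simp [finSumFinEquiv_symm_apply_natAdd, Matrix.fromBlocks_apply₂₂, Jy]

/-- Auxiliary step `det_PsiDeriv`. [bookkeeping] -/
theorem det_PsiDeriv (F : Fin k → MvPolynomial (Fin (n + k)) ℚ) (z₀ : Fin (n + k) → ℝ) :
    (PsiDeriv F z₀).det = (Jy F z₀).det := by
  rw [ContinuousLinearMap.det, ← LinearMap.det_toMatrix', toMatrix_PsiDeriv, Matrix.det_reindex_self,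
    Matrix.det_fromBlocks_zero₁₂, Matrix.det_one, one_mul]

/-! ### §4e.3  The local analytic inverse of `Ψ_F` at an étale point -/

section LocalInverse

variable (F : Fin k → MvPolynomial (Fin (n + k)) ℚ) (z₀ : Fin (n + k) → ℝ)

/-- The derivative of `Ψ_F` at `z₀` as a continuous linear equivalence, when `det ∂F/∂y (z₀) ≠ 0`. -/
def PsiEquiv (hJ : (Jy F z₀).det ≠ 0) : (Fin (n + k) → ℝ) ≃L[ℝ] (Fin (n + k) → ℝ) :=
  (PsiDeriv F z₀).toContinuousLinearEquivOfDetNeZero (by rw [det_PsiDeriv]; exact hJ)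

/-- Auxiliary step `coe_PsiEquiv`. [bookkeeping] -/
theorem coe_PsiEquiv (hJ : (Jy F z₀).det ≠ 0) :
    (PsiEquiv F z₀ hJ : (Fin (n + k) → ℝ) →L[ℝ] (Fin (n + k) → ℝ)) = PsiDeriv F z₀ :=
  ContinuousLinearMap.coe_toContinuousLinearEquivOfDetNeZero _ _

/-- Auxiliary step `hasStrictFDerivAt_Psi_equiv`. [bookkeeping] -/
theorem hasStrictFDerivAt_Psi_equiv (hJ : (Jy F z₀).det ≠ 0) :
    HasStrictFDerivAt (Psi F)
      (PsiEquiv F z₀ hJ : (Fin (n + k) → ℝ) →L[ℝ] (Fin (n + k) → ℝ)) z₀ := by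
  rw [coe_PsiEquiv]
  exact hasStrictFDerivAt_Psi F z₀

/-- The local homeomorphism `R_F` at `z₀` given by the inverse function theorem. -/
def locHomeo (hJ : (Jy F z₀).det ≠ 0) :
    OpenPartialHomeomorph (Fin (n + k) → ℝ) (Fin (n + k) → ℝ) :=
  (hasStrictFDerivAt_Psi_equiv F z₀ hJ).toOpenPartialHomeomorph (Psi F)

/-- Auxiliary step `locHomeo_coe`. [bookkeeping] -/
theorem locHomeo_coe (hJ : (Jy F z₀).det ≠ 0) : ⇑(locHomeo F z₀ hJ) = Psi F :=
  HasStrictFDerivAt.toOpenPartialHomeomorph_coe _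

/-- Membership in `locHomeo_source`, unfolded. [bookkeeping] -/
theorem mem_locHomeo_source (hJ : (Jy F z₀).det ≠ 0) : z₀ ∈ (locHomeo F z₀ hJ).source :=
  HasStrictFDerivAt.mem_toOpenPartialHomeomorph_source _

/-- **Analytic inverse function theorem** for `Ψ_F`: the local inverse is real-analytic at
`Ψ_F(z₀)`. -/
theorem analyticAt_locHomeo_symm (hJ : (Jy F z₀).det ≠ 0) :
    AnalyticAt ℝ (locHomeo F z₀ hJ).symm (Psi F z₀) := by
  obtain ⟨p, hp⟩ := analyticAt_Psi F z₀
  have h1 : p 1 = (continuousMultilinearCurryFin1 ℝ (Fin (n + k) → ℝ) (Fin (n + k) → ℝ)).symm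
      (PsiEquiv F z₀ hJ : (Fin (n + k) → ℝ) →L[ℝ] (Fin (n + k) → ℝ)) := by
    rw [coe_PsiEquiv, ← (hasStrictFDerivAt_Psi F z₀).hasFDerivAt.fderiv, hp.fderiv_eq,
      LinearIsometryEquiv.symm_apply_apply]
  have hp' : HasFPowerSeriesAt (locHomeo F z₀ hJ) p z₀ := by
    rw [locHomeo_coe]
    exact hp
  have := (locHomeo F z₀ hJ).hasFPowerSeriesAt_symm (mem_locHomeo_source F z₀ hJ) hp' h1
  rw [locHomeo_coe] at this
  exact this.analyticAt

end LocalInverse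

/-- The `x`-cylinder over a rational box is `ℚ`-semialgebraic in `ℝⁿ⁺ᵏ`. -/
theorem isSemialgebraic_cylinder (a b : Fin n → ℚ) :
    IsSemialgebraic ℚ {z : Fin (n + k) → ℝ | (fun i => z (Fin.castAdd k i)) ∈ ratBox a b} := by
  classical
  have h : {z : Fin (n + k) → ℝ | (fun i => z (Fin.castAdd k i)) ∈ ratBox a b} =
      ⋂ i ∈ (Finset.univ : Finset (Fin n)),
      ({z : Fin (n + k) → ℝ | 0 < MvPolynomial.aeval z
          (X (Fin.castAdd k i) - C (a i) : MvPolynomial (Fin (n + k)) ℚ)} ∩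
        {z : Fin (n + k) → ℝ | 0 < MvPolynomial.aeval z
          (C (b i) - X (Fin.castAdd k i) : MvPolynomial (Fin (n + k)) ℚ)}) := by
    ext z
    simp [ratBox, sub_pos]
  rw [h]
  exact IsSemialgebraic.biInter _ _ fun i _ =>
    (isSemialgebraic_setOf_eval_pos _).inter (isSemialgebraic_setOf_eval_pos _)

/-! ### §4e.4  The `ℚ`-Nash implicit function theorem -/

/-- The embedding `x ↦ (x, 0) ∈ ℝⁿ⁺ᵏ`. -/
def emb0 (k : ℕ) (x : Fin n → ℝ) : Fin (n + k) → ℝ := Fin.append x (0 : Fin k → ℝ)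

/-- Auxiliary step `emb0_castAdd`. [bookkeeping] -/
@[simp] theorem emb0_castAdd (x : Fin n → ℝ) (i : Fin n) : emb0 k x (Fin.castAdd k i) = x i := by
  simp [emb0]

/-- Auxiliary step `emb0_natAdd`. [bookkeeping] -/
@[simp] theorem emb0_natAdd (x : Fin n → ℝ) (j : Fin k) : emb0 k x (Fin.natAdd n j) = 0 := by
  simp [emb0]

/-- Auxiliary step `continuous_emb0`. [bookkeeping] -/
theorem continuous_emb0 : Continuous (emb0 (n := n) k) := by
  refine continuous_pi fun r => ?_
  induction r using Fin.addCases with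
  | left i =>
    simp only [emb0_castAdd]
    exact continuous_apply i
  | right j =>
    simp only [emb0_natAdd]
    exact continuous_const

/-- Auxiliary step `analyticAt_emb0`. [bookkeeping] -/
theorem analyticAt_emb0 (x : Fin n → ℝ) : AnalyticAt ℝ (emb0 (n := n) k) x := by
  have : emb0 (n := n) k = fun x r => (fun r x => emb0 k x r) r x := rfl
  rw [this]
  apply AnalyticAt.pi
  intro r
  induction r using Fin.addCases with
  | left i =>
    simp only [emb0_castAdd]
    exact (ContinuousLinearMap.proj (R := ℝ) (φ := fun _ : Fin n => ℝ) i).analyticAt x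
  | right j =>
    simp only [emb0_natAdd]
    exact analyticAt_const

/-- Auxiliary step `Psi_eq_emb0`. [bookkeeping] -/
theorem Psi_eq_emb0 (F : Fin k → MvPolynomial (Fin (n + k)) ℚ) {z : Fin (n + k) → ℝ}
    (hF : ∀ i, MvPolynomial.aeval z (F i) = 0) :
    Psi F z = emb0 k (fun i => z (Fin.castAdd k i)) := by
  funext r
  induction r using Fin.addCases with
  | left i => simp [Psi, emb0]
  | right j => simp [Psi, emb0, hF j]

end NashImplicit
end
end Summit.KontsevichZagierPeriods.RootDecompRationalCubeDichotomy.Rung29430.MultiGen
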